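import Mathlib
import Literature.Computability.AlgebraicComplexity.OrbitCoordinateRing
import Literature.Computability.AlgebraicComplexity.ChowHighestWeight
import Literature.NumberTheory.DiophantineGeometry.GLHighestWeight
import Literature.NumberTheory.DiophantineGeometry.SchurWeylPlethysm
import Literature.NumberTheory.DiophantineGeometry.SchurWeylPlethysmOrbitWeightsProofs

/-!
# The semigroup floor — explicit / elementary proof
(crux `ValuativeGCT.ValuativeFlip`, stmt-ValiantsHypothesis-12624; registered stub `semigroupFloor`;
siege variation "explicit / elementary route")

In the coordinate ring `ℂ[Δ_m(f)] = OrbitCoordRing f m` of the orbit closure of ANY polynomial `f`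
(`m ≠ 0`), `D + 1` algebraically independent highest-weight vectors `F₀, …, F_D` of one weight `χ`
force `orbitMultiplicity ℂ f m (k • χ) ≥ C(k + D, D)` for every `k`.

The proof is the explicit one.  The witnesses are the `C(k + D, D)` monomials
`b_s = ∏_{i ∈ s} F_i`, indexed by the multisets `s` of size `k` on `Fin (D + 1)`
(`Sym (Fin (D + 1)) k`, counted by stars and bars, `Sym.card_sym_eq_choose`):
* an upper triangular `g` acts on `ℂ[Δ_m(f)]` by an algebra endomorphism, so it multiplies `b_s` by
  `χ(g)^k = (k • χ)(g)` (`orbitCoordRep_multisetProd`, `Multiset.smul_prod`, `weightChar_nsmul`) —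
  each `b_s` is a highest-weight vector of weight `k • χ`;
* `b_s` is the image of the monomial `X^s` under `MvPolynomial.aeval F`, which is injective by
  algebraic independence, and distinct monomials are linearly independent — so the `b_s` are
  linearly independent (`linearIndependent_symMonomial`);
* the highest-weight space of weight `k • χ` is finite-dimensional for `m ≠ 0`
  (`finiteDimensional_highestWeightSpace_orbitCoordRep_holds`, a weight pins the degree), so its
  dimension `orbitMultiplicity ℂ f m (k • χ)` is at least the number of the `b_s`.

No filtration / graded-monoid machinery is used (compare the abstract `stub_gradedFloor` route of
`Theorems/ValuativeGCTValuativeFlipSemigroupFloor.lean`).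

Sources: Kaveh–Khovanskii, Ann. Math. 176 (2012) §1 (semigroups of graded algebras);
BLMW, SIAM J. Comput. 40 (2011) §5.2 (weight pins degree); folklore.
-/

set_option linter.dupNamespace false

namespace Summit.ValiantsHypothesis.ValiantsHypothesis.Theorems.ValuativeFlip.SemigroupFloorExplicitK2

open Literature.NumberTheory.DiophantineGeometry Literature.Computability.AlgebraicComplexity

noncomputable section

/-- **The Borel action on an explicit monomial.**  If every `F i` is a highest-weight vector of
weight `χ` in `ℂ[Δ_m(f)]`, then an upper triangular `g` multiplies the monomial `∏_{i ∈ s} F i`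
(`s` a multiset of indices) by `χ(g) ^ |s|`: `g` acts by the algebra endomorphism
`orbitCoordSubst f m g`. [folklore] -/
theorem orbitCoordRep_multisetProd {σ : Type} [Fintype σ] [LinearOrder σ] (f : MvPolynomial σ ℂ)
    (m : ℕ) (χ : Weight σ) {ι : Type} (F : ι → OrbitCoordRing f m)
    (hF : ∀ i, F i ∈ highestWeightSpace (orbitCoordRep f m) χ) (s : Multiset ι) {g : GL σ ℂ}
    (hg : IsUpperTriangular g) :
    orbitCoordRep f m g (s.map F).prod = weightChar χ g ^ Multiset.card s • (s.map F).prod := by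
  rw [orbitCoordRep_apply, map_multiset_prod, Multiset.map_map]
  have h : s.map (⇑(orbitCoordSubst f m g) ∘ F) = (s.map F).map (weightChar χ g • ·) := by
    rw [Multiset.map_map]
    refine Multiset.map_congr rfl fun i _ => ?_
    simp only [Function.comp_apply]
    rw [← orbitCoordRep_apply]
    exact hF i g hg
  rw [h, ← Multiset.smul_prod, Multiset.card_map]

/-- **Explicit monomials are highest-weight vectors.**  For highest-weight vectors `F i` of weight
`χ` in `ℂ[Δ_m(f)]` and a multiset `s` of indices, `∏_{i ∈ s} F i` is a highest-weight vector of
weight `|s| • χ` (`(|s| • χ)(g) = χ(g) ^ |s|` on the Borel subgroup). [folklore] -/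
theorem multisetProd_mem_highestWeightSpace {σ : Type} [Fintype σ] [LinearOrder σ]
    (f : MvPolynomial σ ℂ) (m : ℕ) (χ : Weight σ) {ι : Type} (F : ι → OrbitCoordRing f m)
    (hF : ∀ i, F i ∈ highestWeightSpace (orbitCoordRep f m) χ) (s : Multiset ι) :
    (s.map F).prod ∈ highestWeightSpace (orbitCoordRep f m) (Multiset.card s • χ) := by
  intro g hg
  rw [orbitCoordRep_multisetProd f m χ F hF s hg, weightChar_nsmul _ _ hg]

/-- **Explicit monomials in an algebraically independent family are linearly independent.**  In a
commutative `ℂ`-algebra `R`, if `F : ι → R` is algebraically independent then the degree-`k`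
monomials `s ↦ ∏_{i ∈ s} F i` (`s : Sym ι k`) are linearly independent: `∏_{i ∈ s} F i` is the image
of the monomial `X^s` under the injective algebra map `MvPolynomial.aeval F`, and distinct monomials
of `MvPolynomial ι ℂ` are linearly independent (`MvPolynomial.basisMonomials`). [folklore] -/
theorem linearIndependent_symMonomial {R : Type} [CommRing R] [Algebra ℂ R] {ι : Type}
    [DecidableEq ι] (F : ι → R) (hind : AlgebraicIndependent ℂ F) (k : ℕ) :
    LinearIndependent ℂ (fun s : Sym ι k => ((s : Multiset ι).map F).prod) := by
  -- `∏_{i ∈ s} F i = aeval F (X^s)`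
  have hprod : ∀ s : Sym ι k, ((s : Multiset ι).map F).prod =
      MvPolynomial.aeval F
        (MvPolynomial.monomial (Multiset.toFinsupp (s : Multiset ι)) (1 : ℂ)) := by
    intro s
    rw [MvPolynomial.aeval_monomial, map_one, one_mul, Finsupp.prod, Multiset.toFinsupp_support,
      Finset.prod_multiset_map_count]
    refine Finset.prod_congr rfl fun i _ => ?_
    rw [Multiset.toFinsupp_apply]
  -- distinct multisets have distinct exponent vectors
  have he : Function.Injective (fun s : Sym ι k => Multiset.toFinsupp (s : Multiset ι)) :=
    fun s t hst => Sym.coe_injective (Multiset.toFinsupp.injective hst)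
  have h0 := (MvPolynomial.basisMonomials ι ℂ).linearIndependent
  rw [MvPolynomial.coe_basisMonomials] at h0
  have hker : LinearMap.ker
      (MvPolynomial.aeval F : MvPolynomial ι ℂ →ₐ[ℂ] R).toLinearMap = ⊥ :=
    LinearMap.ker_eq_bot_of_injective (by
      rw [AlgHom.coe_toLinearMap]
      exact (algebraicIndependent_iff_injective_aeval.mp hind))
  have h2 := (h0.comp _ he).map' _ hker
  rw [AlgHom.coe_toLinearMap] at h2
  have hfun : (fun s : Sym ι k => ((s : Multiset ι).map F).prod) =
      ⇑(MvPolynomial.aeval F : MvPolynomial ι ℂ →ₐ[ℂ] R) ∘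
        (fun e : ι →₀ ℕ => MvPolynomial.monomial e (1 : ℂ)) ∘
          (fun s : Sym ι k => Multiset.toFinsupp (s : Multiset ι)) := by
    funext s
    exact hprod s
  rw [hfun]
  exact h2

/-- **The semigroup floor** (registered stub `semigroupFloor` of crux `ValuativeGCT.ValuativeFlip`,
explicit proof).  In the coordinate ring `ℂ[Δ_m(f)]` of the orbit closure of ANY polynomial `f`
(`m ≠ 0`), `D + 1` algebraically independent highest-weight vectors `F₀, …, F_D` of weight `χ` force
`C(k + D, D) ≤ orbitMultiplicity ℂ f m (k • χ)` for every `k`: the `C(k + D, D)` explicit monomials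
`∏_{i ∈ s} F i` (`s : Sym (Fin (D + 1)) k`) are linearly independent highest-weight vectors of weight
`k • χ` (`multisetProd_mem_highestWeightSpace`, `linearIndependent_symMonomial`) inside the
finite-dimensional highest-weight space (`finiteDimensional_highestWeightSpace_orbitCoordRep_holds`).
[Kaveh–Khovanskii 2012 §1; BLMW 2011 §5.2; folklore] -/
theorem semigroupFloor {σ : Type} [Fintype σ] [LinearOrder σ] (f : MvPolynomial σ ℂ) {m : ℕ}
    (hm : m ≠ 0) (χ : Weight σ) (D : ℕ) (F : Fin (D + 1) → OrbitCoordRing f m)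
    (hF : ∀ i, F i ∈ highestWeightSpace (orbitCoordRep f m) χ) (hind : AlgebraicIndependent ℂ F)
    (k : ℕ) : (k + D).choose D ≤ orbitMultiplicity ℂ f m (k • χ) := by
  haveI : FiniteDimensional ℂ ↥(highestWeightSpace (orbitCoordRep f m) (k • χ)) :=
    finiteDimensional_highestWeightSpace_orbitCoordRep_holds (k := ℂ) f hm (k • χ)
  -- the explicit witnesses `b s = ∏_{i ∈ s} F i`, `s` a multiset of size `k` on `Fin (D + 1)`
  have hmem : ∀ s : Sym (Fin (D + 1)) k,
      ((s : Multiset (Fin (D + 1))).map F).prod ∈ highestWeightSpace (orbitCoordRep f m) (k • χ) := by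
    intro s
    have h := multisetProd_mem_highestWeightSpace f m χ F hF (s : Multiset (Fin (D + 1)))
    rwa [Sym.card_coe] at h
  -- they are linearly independent in `ℂ[Δ_m(f)]`, hence in the highest-weight space
  have hli : LinearIndependent ℂ (fun s : Sym (Fin (D + 1)) k =>
      (⟨_, hmem s⟩ : ↥(highestWeightSpace (orbitCoordRep f m) (k • χ)))) := by
    refine LinearIndependent.of_comp (highestWeightSpace (orbitCoordRep f m) (k • χ)).subtype ?_
    exact linearIndependent_symMonomial F hind k
  -- and there are `C(k + D, D)` of them
  have hcard := hli.fintype_card_le_finrank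
  rw [Sym.card_sym_eq_choose, Fintype.card_fin, show D + 1 + k - 1 = k + D by omega,
    Nat.choose_symm_add] at hcard
  exact hcard

end

end Summit.ValiantsHypothesis.ValiantsHypothesis.Theorems.ValuativeFlip.SemigroupFloorExplicitK2
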